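import Literature.Claims.NS.Shlygin2026
import Literature.Analysis.FluidPDE.AncientMildDrift
import HarnessLib

/-!
# C151 `Shlygin2026` — refutation kit (ns-claims-refuter-3 g4, refuter of record)

**First failing step (print order of the printed proof of Thm 6.2, p.9 l.34–35: Type I first, by
Thm 2.17 ⇐ Thm 2.16 + Thm 2.5):** `Literature.Claims.NS.Shlygin2026.Theorem25_BoundedLiouville`
(skeleton l.227) = **Theorem 2.5 p.3 l.56–59** «(Bounded ancient Liouville theorem). Any bounded smooth
ancient mild solution on ℝ³ × (−∞,0] is identically zero. [5]» — consumed on BOTH branches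
(`typeIExcluded_of`, `typeIIExcluded_of` → `noBlowup_of` → `clayA_of_printed_steps`).

**Countermodel (the canonical obstruction of the subject, not a junk witness):** the constant flow
`u(t, x) = e₀` (`‖e₀‖ = 1`, pressure `0`) is a bounded, smooth, ancient, mild solution for every `ν`
— in the tree's KNSS duality class by `Literature.Analysis.FluidPDE.isBoundedAncientMildSolution_timeConst`
(Koch–Nadirashvili–Seregin–Šverák 2009 §1: the «parasitic solutions» `u(x,t) = b(t)`; the Liouville
CONJECTURE asserts «bounded ancient mild ⇒ constant», open in 3-D) — and it is not zero at `t = −1`.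
It satisfies every hypothesis the printed Type I argument extracts (bounded, ancient, mild, smooth,
`|ũ(0,0)| = 1`), so the charitable reading «… is constant» (KNSS) does not rescue Thm 2.17 either
(ref-3 g6 RETYPE v0 K1/K2; typist-1 g5's flag (i)/(ii) on the decl).

WHAT THIS IS NOT: not a claim about NS regularity or blow-up; not a claim about any author beyond the typed
locator.
-/

set_option linter.dupNamespace false

open Set
open scoped ContDiff

namespace Summit.NavierStokesRegularity.NavierStokesRegularity.Theorems.Shlygin2026

open Literature.Analysis.FluidPDE

noncomputable section

/-- `ℝ³`. [folklore] -/
abbrev E3 := EuclideanSpace ℝ (Fin 3)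

/-- The unit vector `e₀`. [folklore] -/
def e0 : E3 := EuclideanSpace.single 0 1

/-- `‖e₀‖ = 1`. [folklore] -/
theorem norm_e0 : ‖e0‖ = 1 := by
  simp [e0]

/-- `e₀ ≠ 0`. [folklore] -/
theorem e0_ne_zero : e0 ≠ 0 := by
  intro h; have := norm_e0; rw [h, norm_zero] at this; exact zero_ne_one this

/-- The constant flow `u(t, x) = e₀`. [folklore] -/
def uc : ℝ → E3 → E3 := fun _ _ => e0

/-- The constant flow is a bounded ancient mild solution in the KNSS duality class, for every `ν`
(the «parasitic solutions» `u(x,t) = b(t)` with `b` constant).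
[cite: KochNadirashviliSereginSverak2009, §1 p. 3 (parasitic solutions u(x,t) = b(t))] -/
theorem uc_isBoundedAncientMild (ν : ℝ) : IsBoundedAncientMildSolution ν uc :=
  isBoundedAncientMildSolution_timeConst ν (b := fun _ => e0) ⟨1, fun _ _ => norm_e0.le⟩

/-- Every slice of the constant flow is smooth. [folklore] -/
theorem uc_slice_contDiff (t : ℝ) : ContDiff ℝ ∞ (uc t) := contDiff_const

/-- **Refutes `Shlygin2026.Theorem25_BoundedLiouville` [refuted-substantive]: Theorem 2.5 p.3 l.56–59
AS PRINTED («any bounded smooth ancient mild solution on ℝ³ × (−∞,0] is identically zero») is false —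
the constant flow `u ≡ e₀` is a bounded smooth ancient mild solution (KNSS class) with `u(−1, 0) = e₀ ≠ 0`.
Repair census: the intended statement «… is constant» is the KNSS Liouville conjecture (open in 3-D) and,
even granted, leaves Thm 2.17's contradiction step without force (a constant limit with `|ũ(0,0)| = 1`
is allowed); adding decay / `L³` / finite energy to the hypothesis removes the constants but no such
clause is printed and the Type I limit of Thm 2.16 carries only `L^∞` bounds — no cheap repair.
[cite: Shlygin2026, Thm 2.5 p.3 l.56–59] [cite: KochNadirashviliSereginSverak2009, §1 p. 3 (parasitic solutions u(x,t) = b(t))] -/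
theorem not_Theorem25_BoundedLiouville : ¬ Literature.Claims.NS.Shlygin2026.Theorem25_BoundedLiouville := by
  intro h
  have h0 : uc (-1) 0 = 0 :=
    h 1 one_pos uc (uc_isBoundedAncientMild 1) (fun t _ => uc_slice_contDiff t) (-1) (by norm_num) 0
  exact e0_ne_zero h0

/-- The same witness is «nontrivial» in the skeleton's sense (`IsNontrivialAncient`), i.e. it meets every
hypothesis Thm 2.17's proof feeds into Thm 2.5 (bounded, ancient, mild, smooth, nontrivial) — so the
KNSS-charitable retype «… is constant» does not restore the Type I contradiction (records-grade
companion; not a refutation of any decl). [cite: Shlygin2026, Thm 2.16–2.17 p.4 l.61–68] -/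
theorem uc_isNontrivialAncient : Literature.Claims.NS.Shlygin2026.IsNontrivialAncient uc := by
  intro h
  exact e0_ne_zero (h (-1) (by norm_num) 0)

end

end Summit.NavierStokesRegularity.NavierStokesRegularity.Theorems.Shlygin2026
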